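import Summits.BirchSwinnertonDyer.BirchSwinnertonDyer.Theorems.ManinLocalTwoThreeModularDegreeAtkinLehnerDivisibility
import HarnessLib

/-!
# Step (1) of THEOREM L♮ in the kernel: `ε_Q = +1` ⟹ `2·t_Q = 0`; no rational `2`-torsion and `t_Q ∈ E(ℚ)` ⟹ `φ ∘ w(Q) = φ`; hence
# `2^{#S} ∣ deg φ` for every set `S` of primes of `N` with `w_{Q_p} f = f` (`p ∈ S`) — E-es-173♭ `ALPlusKernelFullLaw` modulo cusp rationality
(cell bsd-f2-manin, prover p2 gen 20; `--supports stmt-BirchSwinnertonDyer-22967`; es MEMO-es §57.11.2 Step (1) = Dummigan–Krishnamoorthy 2013 Prop. 2.1 shape)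

* `two_nsmul_atkinLehnerCuspPoint_eq_zero` — if `w_Q f = f` then the cusp point `t_Q = φ(w(Q)∞)` is `2`-torsion: `φ(w(Q)w(Q)τ) = φ(τ)`
  (`w(Q)² ∈ Q·Γ₀(N)`) and `= φ(τ) + 2t_Q` (tree `φ_atkinLehnerW_smul`).  KERNEL, no printed input.
* `atkinLehnerCuspPoint_eq_zero_of_rational` — if moreover `t_Q` is (the base change of) a RATIONAL point and `E(ℚ)` has no point of order `2`, then
  `t_Q = 0`; `φ_atkinLehnerW_smul_eq_self` — then `φ(w(Q)τ) = φ(τ)` on `ℍ`.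
* **`two_pow_card_dvd_modularDegree_of_atkinLehner_eq_self`** — for a set `S` of primes of `N` with `w_{Q_p} f = f`, `t_{Q_p} ∈ E(ℚ)` (`p ∈ S`) and
  `E(ℚ)[2] = 0` (point form): `2^{#S} ∣ deg φ` (p2 g20 `two_pow_card_dvd_modularDegree_of_φ_atkinLehnerW_smul`); with `S` = all primes of `N` this is
  E-es-173♭'s conclusion `2^{ω(N)} ∣ deg φ` (`two_pow_card_primeFactors_dvd_modularDegree_of_atkinLehner_eq_self`).
THE ONE NON-KERNEL INPUT is displayed as the hypothesis `hrat`: `t_Q = φ(cusp x/(N/Q))` is ℚ-rational — in print: the cusp `1/(N/Q)` of `X₀(N)` is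
defined over `ℚ(ζ_{gcd(Q,N/Q)}) = ℚ` (Ogg; Stevens 1982 Thm. 1.3.1) and `φ` is a ℚ-morphism; the tree states the `X₁(N)`-analogue as the fact F★
`optimalGamma1Parametrization_cusp_rational` (its TODO notes the `X₀(N)`/non-optimal form).  The `2`-torsion hypothesis is stated on POINTS
(`∀ P ∈ E(ℚ), 2P = 0 → P = 0`); es's rows use `ConwayCut.HasRationalTwoTorsion` (a rational root of `twoTorsionPolynomial`), to which it bridges by
the `2`-division polynomial (not done here).
HONEST FRAMING: Step (1) only; THEOREM L♮'s Steps (2)–(5) (quotient curve, THEOREM A♯, CM fields of Fix w_Q) are out of reach; E-es-173/173♭ as TYPED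
are not closed here (the printed input; the point-vs-polynomial form of the `2`-torsion binder); C2, Manin's conjecture and BSD are not proved.
[cite: AtkinLehner1970, Lemmas 8–10 and Thm. 3] [cite: Stevens1982, Thm. 1.3.1] [cite: Knapp1993, Lemma 9.24]
-/

set_option autoImplicit false
-- lint-debt: the directory name repeats the summit name (sibling precedent `ManinLocalTwoThreeModularDegreeAtkinLehnerDivisibility.lean`)
set_option linter.dupNamespace false

noncomputable section

open scoped MatrixGroups ModularForm
open CongruenceSubgroup Matrix.SpecialLinearGroup UpperHalfPlane
open Literature.NumberTheory.EllipticCurves Literature.NumberTheory.EllipticCurves.ModularForms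

namespace Summit.BirchSwinnertonDyer.BirchSwinnertonDyer.Theorems.ManinLocalTwoThree.AtkinLehnerOrbit

variable {N : ℕ} [NeZero N] {W : WeierstrassCurve ℚ}

/-! ## §1 `ε_Q = +1` ⟹ `2·t_Q = 0` (kernel) -/

/-- **If `w_Q f = f` then `2·t_Q = 0`** for the cusp point `t_Q = D.atkinLehnerCuspPoint Q` (`Q ∥ N`): `φ(w(Q)(w(Q)τ)) = φ(τ)` since
`w(Q)² ∈ Q·Γ₀(N)`, and `= φ(τ) + 2t_Q` by `φ_atkinLehnerW_smul`. [cite: Knapp1993, Lemma 9.24] -/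
theorem two_nsmul_atkinLehnerCuspPoint_eq_zero (D : ModularParametrizationData W N) {Q : ℕ} [NeZero Q] (hQN : Q ∣ N)
    (hc : Nat.Coprime Q (N / Q)) (hε : atkinLehnerInvolution N 2 Q D.f = D.f) :
    2 • D.atkinLehnerCuspPoint Q = 0 := by
  have hε' : atkinLehnerInvolution N 2 Q D.f = ((1 : ℤ) : ℂ) • D.f := by rw [hε, Int.cast_one, one_smul]
  obtain ⟨γ₀, hγ₀, hγ⟩ := exists_atkinLehnerW_smul_atkinLehnerW_smul hQN hc (N := N)
  set τ : ℍ := UpperHalfPlane.I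
  have h1 := D.φ_atkinLehnerW_smul hQN hc hε' (glCast (atkinLehnerW N Q : GL (Fin 2) ℚ) • τ)
  have h2 := D.φ_atkinLehnerW_smul hQN hc hε' τ
  have h0 : D.φ (glCast (atkinLehnerW N Q : GL (Fin 2) ℚ) • (glCast (atkinLehnerW N Q : GL (Fin 2) ℚ) • τ)) = D.φ τ := by
    rw [hγ τ]
    exact D.φ_gamma0_smul_holds' ⟨γ₀, hγ₀⟩ τ
  rw [h0, h2, one_zsmul, one_zsmul, add_assoc] at h1
  have h3 : D.φ τ + 0 = D.φ τ + (D.atkinLehnerCuspPoint Q + D.atkinLehnerCuspPoint Q) := by rw [add_zero]; exact h1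
  rw [two_nsmul]
  exact (add_left_cancel h3).symm

/-! ## §2 With `t_Q` rational and no rational `2`-torsion: `t_Q = 0`, `φ∘w(Q) = φ` -/

/-- **`t_Q = 0`** when `w_Q f = f`, `t_Q` is the base change of a rational point, and `E(ℚ)` has no point of order `2`. The rationality of
`t_Q = φ(cusp x/(N/Q))` is the printed input (hypothesis `hrat`). [cite: Stevens1982, Thm. 1.3.1] -/
theorem atkinLehnerCuspPoint_eq_zero_of_rational (D : ModularParametrizationData W N) {Q : ℕ} [NeZero Q] (hQN : Q ∣ N)
    (hc : Nat.Coprime Q (N / Q)) (hε : atkinLehnerInvolution N 2 Q D.f = D.f)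
    (hrat : ∃ P : (W.baseChange ℚ).toAffine.Point,
      WeierstrassCurve.Affine.Point.baseChange (W' := W) ℚ ℂ P = D.atkinLehnerCuspPoint Q)
    (hE2 : ∀ P : (W.baseChange ℚ).toAffine.Point, 2 • P = 0 → P = 0) :
    D.atkinLehnerCuspPoint Q = 0 := by
  obtain ⟨P, hP⟩ := hrat
  have h2 := two_nsmul_atkinLehnerCuspPoint_eq_zero D hQN hc hε
  rw [← hP, ← map_nsmul] at h2
  have hinj : Function.Injective (WeierstrassCurve.Affine.Point.baseChange (W' := W) ℚ ℂ) :=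
    WeierstrassCurve.Affine.Point.map_injective (W' := W) (Algebra.ofId ℚ ℂ)
  have hP0 : P = 0 := hE2 P (hinj (by rw [h2, map_zero]))
  rw [← hP, hP0, map_zero]

/-- **`φ(w(Q)τ) = φ(τ)`** when `w_Q f = f` and `t_Q = 0`. [cite: Knapp1993, Lemma 9.24] -/
theorem φ_atkinLehnerW_smul_eq_self (D : ModularParametrizationData W N) {Q : ℕ} [NeZero Q] (hQN : Q ∣ N)
    (hc : Nat.Coprime Q (N / Q)) (hε : atkinLehnerInvolution N 2 Q D.f = D.f) (ht : D.atkinLehnerCuspPoint Q = 0) (τ : ℍ) :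
    D.φ (glCast (atkinLehnerW N Q : GL (Fin 2) ℚ) • τ) = D.φ τ := by
  have hε' : atkinLehnerInvolution N 2 Q D.f = ((1 : ℤ) : ℂ) • D.f := by rw [hε, Int.cast_one, one_smul]
  rw [D.φ_atkinLehnerW_smul hQN hc hε' τ, ht, add_zero, one_zsmul]

/-! ## §3 `2^{#S} ∣ deg φ` -/

/-- **`2^{#S} ∣ deg φ`** for any modular parametrisation datum `D` of `W` at level `N` and any set `S` of primes of `N` such that, for each
`p ∈ S` (`Q_p = p^{v_p(N)}`): `w_{Q_p} f = f`, and the cusp point `t_{Q_p}` is the base change of a rational point — provided `E(ℚ)` has no point of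
order `2`.  (Step (1) of MEMO-es §57.11.2 / Dummigan–Krishnamoorthy Prop. 2.1 shape; fibre count: p2 g20 `two_pow_card_dvd_modularDegree_of_φ_atkinLehnerW_smul`.)
[cite: AtkinLehner1970, Thm. 3] [cite: Stevens1982, Thm. 1.3.1] -/
theorem two_pow_card_dvd_modularDegree_of_atkinLehner_eq_self (D : ModularParametrizationData W N)
    (S : Finset ℕ) (hS : S ⊆ N.primeFactors)
    (hε : ∀ p ∈ S, haveI : NeZero (p ^ N.factorization p) := ⟨(Nat.ordProj_pos N p).ne'⟩
      atkinLehnerInvolution N 2 (p ^ N.factorization p) D.f = D.f)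
    (hrat : ∀ p ∈ S, ∃ P : (W.baseChange ℚ).toAffine.Point,
      WeierstrassCurve.Affine.Point.baseChange (W' := W) ℚ ℂ P = D.atkinLehnerCuspPoint (p ^ N.factorization p))
    (hE2 : ∀ P : (W.baseChange ℚ).toAffine.Point, 2 • P = 0 → P = 0) :
    2 ^ S.card ∣ D.modularDegree := by
  refine two_pow_card_dvd_modularDegree_of_φ_atkinLehnerW_smul D S hS fun p hp τ ↦ ?_
  haveI : NeZero (p ^ N.factorization p) := ⟨(Nat.ordProj_pos N p).ne'⟩
  obtain ⟨hQN, hc⟩ := ordProj_dvd_and_coprime N (hS hp)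
  exact φ_atkinLehnerW_smul_eq_self D hQN hc (hε p hp)
    (atkinLehnerCuspPoint_eq_zero_of_rational D hQN hc (hε p hp) (hrat p hp) hE2) τ

/-- **E-es-173♭'s conclusion `2^{ω(N)} ∣ deg φ`** (all `w_{Q_p} f = f`), modulo the rationality of the cusp points `t_{Q_p}` and with the `2`-torsion
hypothesis on points. [cite: AtkinLehner1970, Thm. 3] [cite: Stevens1982, Thm. 1.3.1] -/
theorem two_pow_card_primeFactors_dvd_modularDegree_of_atkinLehner_eq_self (D : ModularParametrizationData W N)
    (hε : ∀ p ∈ N.primeFactors, haveI : NeZero (p ^ N.factorization p) := ⟨(Nat.ordProj_pos N p).ne'⟩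
      atkinLehnerInvolution N 2 (p ^ N.factorization p) D.f = D.f)
    (hrat : ∀ p ∈ N.primeFactors, ∃ P : (W.baseChange ℚ).toAffine.Point,
      WeierstrassCurve.Affine.Point.baseChange (W' := W) ℚ ℂ P = D.atkinLehnerCuspPoint (p ^ N.factorization p))
    (hE2 : ∀ P : (W.baseChange ℚ).toAffine.Point, 2 • P = 0 → P = 0) :
    2 ^ N.primeFactors.card ∣ D.modularDegree :=
  two_pow_card_dvd_modularDegree_of_atkinLehner_eq_self D N.primeFactors subset_rfl hε hrat hE2

end Summit.BirchSwinnertonDyer.BirchSwinnertonDyer.Theorems.ManinLocalTwoThree.AtkinLehnerOrbit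

end
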